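import Literature.Analysis.Convolution.RenewalResolvent
import Literature.Analysis.Convolution.RenewalResolventPole
import Summits.NavierStokesRegularity.OSWSelfSimilar.SheetRRenewalBookkeeping
import HarnessLib

/-!
# SHEET-ℝ, towards «linearly stable modulo gauge» (renewal route): THE SCALAR RENEWAL THEOREM, end to end

HONEST FRAMING (cell ns-blowup GROUP B / zone Z3, case Z3-SR-SPEC, P-list (P9)/(P10); design memo `HOME/profile/cert/cert5/P9-P10-RENEWAL-DESIGN.md` v2
§1 and bricks (R-b) `SheetRRenewalBookkeeping`, (R-b′) `Literature/Analysis/Convolution/RenewalResolvent`, (R-c)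
`Literature/Analysis/Convolution/RenewalResolventPole`; profile-lead RULING (hr)(3): (P10) NOT NEEDED, nothing bought — 0 kit). 1-D MODEL frame; not Euler/NS;
«violates: none — MODEL». WHAT THIS IS NOT: not NS; not a semigroup; no operator, no profile, no number of record moves.

THE THEOREM (`norm_renewal_sub_mode_le`). Let the scalar renewal kernel `k` be `C¹` on `(0,∞)`, continuous on `[0,∞)`, with
`‖k(t)‖, ‖k′(t)‖ ≤ K e^{−μt}` (`μ > 0`); let its symbol `E = 1 − 𝓛k` (agreeing with a given `E : ℂ → ℂ` on `Re σ > −μ`) have NO zero in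
`{Re σ > −β₀} ∖ {1}` and a SIMPLE zero at `σ = 1` (`0 < β₀ ≤ μ`) — for the sheet these are the Z3-SR-SPEC (S2) sentences of record read through
`SheetREvansOdd.exists_weakEigen_iff_evansOdd_eq_zero`; let `m₀` be continuous with `‖m₀(t)‖ ≤ C₀e^{−μ₀t}` (`μ₀ > 0`) and `m` a continuous
solution of the renewal equation `m(t) = m₀(t) + ∫₀ᵗ k(t − u) m(u) du` on `[0,∞)`. Then for every `0 < β′ < min(β₀, μ₀)` there is `M` with
    `‖m(t) − E′(1)⁻¹·(∫₀^∞ e^{−s}m₀(s) ds)·e^{t}‖ ≤ M e^{−β′t}`   (`t ≥ 0`):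
the gauge amplitude is the growing mode times the «adjoint pairing» `∫₀^∞ e^{−s}m₀` plus an exponentially decaying remainder, and it DECAYS
exactly on the hyperplane `∫₀^∞ e^{−s}m₀(s) ds = 0` (`norm_renewal_le_of_orthogonal_mode`). ALL analytic inputs are kernel theorems: the resolvent
exists (Neumann series), `m = m₀ + r ⋆ m₀` (variation of constants), `r = e^{t}/E′(1) + L¹(e^{β′t}dt)` (Bromwich inversion + contour shift across
the simple pole), and the bookkeeping of (R-b). What remains for the sheet's word (memo (R-a)/(R-d)): the rank-one mild solution ⇒ renewal equation
(`k(t) = θ⟪h, S(t)f⟫` with selfsim's `SheetRLinearisedSemigroup`), and `E = evansOdd` on `Re σ > −m` by the Laplace bridge. No definition, no named fact.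
-/

noncomputable section

namespace Summit.NavierStokesRegularity.OSWSelfSimilar
namespace SheetRRenewalScalar

open _root_.MeasureTheory _root_.Set _root_.Filter _root_.Real _root_.Complex intervalIntegral
open scoped Topology
open Literature.Analysis.Complex Literature.Analysis.Convolution

/-- **THE SCALAR RENEWAL THEOREM (growing mode + exponentially decaying remainder).** See the module docstring. [folklore] -/
theorem norm_renewal_sub_mode_le {k k' m₀ m : ℝ → ℂ} {E : ℂ → ℂ} {K μ β₀ C₀ μ₀ β' : ℝ}
    (hk : HalfLineExpBound k K (-μ)) (hk' : HalfLineExpBound k' K (-μ)) (hd : ∀ t : ℝ, 0 < t → HasDerivAt k (k' t) t)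
    (hμ : 0 < μ) (hE : ∀ s : ℂ, -μ < s.re → E s = 1 - laplaceC k s) (hβ₀ : 0 < β₀) (hβ₀μ : β₀ ≤ μ)
    (hzero : ∀ s : ℂ, -β₀ < s.re → s ≠ 1 → E s ≠ 0) (hE1 : E 1 = 0) (hE'1 : deriv E 1 ≠ 0)
    (hm₀ : Continuous m₀) (hb₀ : ∀ s : ℝ, 0 ≤ s → ‖m₀ s‖ ≤ C₀ * Real.exp (-μ₀ * s))
    (hm : Continuous m) (hren : ∀ t : ℝ, 0 ≤ t → m t = m₀ t + hconv k m t)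
    (hβ' : 0 < β') (hβ'β₀ : β' < β₀) (hβ'μ₀ : β' < μ₀) :
    ∃ M : ℝ, ∀ t : ℝ, 0 ≤ t →
      ‖m t - (deriv E 1)⁻¹ * (∫ s in Ioi (0 : ℝ), (Real.exp (-s) : ℂ) * m₀ s) * (Real.exp t : ℂ)‖ ≤ M * Real.exp (-β' * t) := by
  -- (R-b′) the resolvent of `k`
  have hK0 : 0 ≤ K := hk.nonneg
  have hkb : ∀ t : ℝ, 0 ≤ t → ‖k t‖ ≤ K := fun t ht =>
    (hk.bound t ht).trans (by
      have : Real.exp (-μ * t) ≤ 1 := Real.exp_le_one_iff.2 (by nlinarith)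
      nlinarith)
  obtain ⟨r, hr, hres, hrb⟩ := exists_resolvent hk.continuous hkb
  -- (R-c) the pole decomposition of the resolvent, at a rate `β` with `β′ < β < β₀`
  set β : ℝ := (β' + β₀) / 2 with hβdef
  have hβ'β : β' < β := by rw [hβdef]; linarith
  have hdata : RenewalPoleData k k' r E K μ K K β β₀ :=
    { hk := hk, hk' := hk', hasDerivAt := hd, hμ := hμ,
      hr := ⟨hr, fun t ht => hrb t ht⟩,
      resolvent_eq := fun t ht => hres t ht,
      hE := hE, hβ := by rw [hβdef]; linarith, hββ₀ := by rw [hβdef]; linarith, hβ₀μ := hβ₀μ,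
      ne_zero := hzero, E_one := hE1, deriv_ne_zero := hE'1 }
  obtain ⟨N', hN'⟩ := hdata.integral_norm_resolvent_sub_exp_le hβ'β
  -- (R-b′) variation of constants: `m = m₀ + r ⋆ m₀`
  have hsol : ∀ t : ℝ, 0 ≤ t → m t = m₀ t + hconv r m₀ t :=
    fun t ht => renewal_solution_eq hk.continuous hr hm hres hren ht
  -- (R-b) the bookkeeping, with `r₁ = r − e^{·}/E′(1)` and `c = E′(1)⁻¹`
  set r₁ : ℝ → ℂ := fun s => r s - cexp s / deriv E 1 with hr₁def
  have hr₁ : Continuous r₁ := hdata.continuous_resolvent_sub_exp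
  have hm' : ∀ t : ℝ, 0 ≤ t → m t = m₀ t + ∫ s in (0 : ℝ)..t,
      ((deriv E 1)⁻¹ * (Real.exp (t - s) : ℂ) + r₁ (t - s)) * m₀ s := by
    intro t ht
    rw [hsol t ht, hconv]
    congr 1
    refine intervalIntegral.integral_congr fun s _ => ?_
    simp only [hr₁def, Complex.ofReal_exp]
    push_cast
    ring
  refine ⟨C₀ + ‖(deriv E 1)⁻¹‖ * C₀ / (1 + μ₀) + C₀ * N', fun t ht => ?_⟩
  exact SheetRRenewalBookkeeping.norm_renewal_sub_growing_le hm₀ hr₁ hβ' hβ'μ₀ hb₀ hN' hm' ht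

/-- **Decay on the adjoint-orthogonal hyperplane.** Under the hypotheses of `norm_renewal_sub_mode_le`, if `∫₀^∞ e^{−s}m₀(s) ds = 0` then
`‖m(t)‖ ≤ M e^{−β′t}` for all `t ≥ 0`. [folklore] -/
theorem norm_renewal_le_of_orthogonal_mode {k k' m₀ m : ℝ → ℂ} {E : ℂ → ℂ} {K μ β₀ C₀ μ₀ β' : ℝ}
    (hk : HalfLineExpBound k K (-μ)) (hk' : HalfLineExpBound k' K (-μ)) (hd : ∀ t : ℝ, 0 < t → HasDerivAt k (k' t) t)
    (hμ : 0 < μ) (hE : ∀ s : ℂ, -μ < s.re → E s = 1 - laplaceC k s) (hβ₀ : 0 < β₀) (hβ₀μ : β₀ ≤ μ)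
    (hzero : ∀ s : ℂ, -β₀ < s.re → s ≠ 1 → E s ≠ 0) (hE1 : E 1 = 0) (hE'1 : deriv E 1 ≠ 0)
    (hm₀ : Continuous m₀) (hb₀ : ∀ s : ℝ, 0 ≤ s → ‖m₀ s‖ ≤ C₀ * Real.exp (-μ₀ * s))
    (hm : Continuous m) (hren : ∀ t : ℝ, 0 ≤ t → m t = m₀ t + hconv k m t)
    (hβ' : 0 < β') (hβ'β₀ : β' < β₀) (hβ'μ₀ : β' < μ₀)
    (horth : ∫ s in Ioi (0 : ℝ), (Real.exp (-s) : ℂ) * m₀ s = 0) :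
    ∃ M : ℝ, ∀ t : ℝ, 0 ≤ t → ‖m t‖ ≤ M * Real.exp (-β' * t) := by
  obtain ⟨M, hM⟩ := norm_renewal_sub_mode_le hk hk' hd hμ hE hβ₀ hβ₀μ hzero hE1 hE'1 hm₀ hb₀ hm hren hβ' hβ'β₀ hβ'μ₀
  refine ⟨M, fun t ht => ?_⟩
  have h := hM t ht
  rwa [horth, mul_zero, zero_mul, sub_zero] at h

/-! ### §2 (APPEND) The constant made uniform in the datum `m₀` -/

/-- **UNIFORM CONSTANT.** Under the kernel/symbol hypotheses of `norm_renewal_sub_mode_le` and `0 < β′ < β₀` there is `N′ ≥ 0` — depending on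
`k`, `E`, `β′` only — such that for EVERY continuous datum `m₀` with `‖m₀(s)‖ ≤ C₀e^{−μ₀s}` (`μ₀ > β′`) and every continuous solution `m` of
`m = m₀ + k ⋆ m` on `[0,∞)`: `‖m(t) − E′(1)⁻¹(∫₀^∞e^{−s}m₀)e^{t}‖ ≤ C₀·(1 + ‖E′(1)⁻¹‖/(1 + μ₀) + N′)·e^{−β′t}` for all `t ≥ 0` (the constant is LINEAR in
`C₀`, as needed for an operator-norm statement over all data `δ₀`). 1-D MODEL frame; not NS. [folklore] -/
theorem exists_uniform_renewal_const {k k' : ℝ → ℂ} {E : ℂ → ℂ} {K μ β₀ β' : ℝ}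
    (hk : HalfLineExpBound k K (-μ)) (hk' : HalfLineExpBound k' K (-μ)) (hd : ∀ t : ℝ, 0 < t → HasDerivAt k (k' t) t)
    (hμ : 0 < μ) (hE : ∀ s : ℂ, -μ < s.re → E s = 1 - laplaceC k s) (hβ₀ : 0 < β₀) (hβ₀μ : β₀ ≤ μ)
    (hzero : ∀ s : ℂ, -β₀ < s.re → s ≠ 1 → E s ≠ 0) (hE1 : E 1 = 0) (hE'1 : deriv E 1 ≠ 0)
    (hβ' : 0 < β') (hβ'β₀ : β' < β₀) :
    ∃ N' : ℝ, 0 ≤ N' ∧ ∀ (m₀ m : ℝ → ℂ) (C₀ μ₀ : ℝ), Continuous m₀ → (∀ s : ℝ, 0 ≤ s → ‖m₀ s‖ ≤ C₀ * Real.exp (-μ₀ * s)) →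
      Continuous m → (∀ t : ℝ, 0 ≤ t → m t = m₀ t + hconv k m t) → β' < μ₀ → ∀ t : ℝ, 0 ≤ t →
        ‖m t - (deriv E 1)⁻¹ * (∫ s in Ioi (0 : ℝ), (Real.exp (-s) : ℂ) * m₀ s) * (Real.exp t : ℂ)‖ ≤
          C₀ * (1 + ‖(deriv E 1)⁻¹‖ / (1 + μ₀) + N') * Real.exp (-β' * t) := by
  -- the resolvent and its pole decomposition do not depend on the datum
  have hK0 : 0 ≤ K := hk.nonneg
  have hkb : ∀ t : ℝ, 0 ≤ t → ‖k t‖ ≤ K := fun t ht =>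
    (hk.bound t ht).trans (by
      have : Real.exp (-μ * t) ≤ 1 := Real.exp_le_one_iff.2 (by nlinarith)
      nlinarith)
  obtain ⟨r, hr, hres, hrb⟩ := exists_resolvent hk.continuous hkb
  set β : ℝ := (β' + β₀) / 2 with hβdef
  have hβ'β : β' < β := by rw [hβdef]; linarith
  have hdata : RenewalPoleData k k' r E K μ K K β β₀ :=
    { hk := hk, hk' := hk', hasDerivAt := hd, hμ := hμ,
      hr := ⟨hr, fun t ht => hrb t ht⟩,
      resolvent_eq := fun t ht => hres t ht,
      hE := hE, hβ := by rw [hβdef]; linarith, hββ₀ := by rw [hβdef]; linarith, hβ₀μ := hβ₀μ,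
      ne_zero := hzero, E_one := hE1, deriv_ne_zero := hE'1 }
  obtain ⟨N', hN'⟩ := hdata.integral_norm_resolvent_sub_exp_le hβ'β
  have hN'0 : 0 ≤ N' := by
    have h0 := hN' 0 le_rfl
    rw [intervalIntegral.integral_same] at h0
    exact h0
  refine ⟨N', hN'0, fun m₀ m C₀ μ₀ hm₀ hb₀ hm hren hβ'μ₀ t ht => ?_⟩
  have hsol : ∀ t : ℝ, 0 ≤ t → m t = m₀ t + hconv r m₀ t :=
    fun t ht => renewal_solution_eq hk.continuous hr hm hres hren ht
  set r₁ : ℝ → ℂ := fun s => r s - cexp s / deriv E 1 with hr₁def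
  have hr₁ : Continuous r₁ := hdata.continuous_resolvent_sub_exp
  have hm' : ∀ t : ℝ, 0 ≤ t → m t = m₀ t + ∫ s in (0 : ℝ)..t,
      ((deriv E 1)⁻¹ * (Real.exp (t - s) : ℂ) + r₁ (t - s)) * m₀ s := by
    intro t ht
    rw [hsol t ht, hconv]
    congr 1
    refine intervalIntegral.integral_congr fun s _ => ?_
    simp only [hr₁def, Complex.ofReal_exp]
    push_cast
    ring
  have key := SheetRRenewalBookkeeping.norm_renewal_sub_growing_le hm₀ hr₁ hβ' hβ'μ₀ hb₀ hN' hm' ht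
  refine key.trans (le_of_eq ?_)
  ring

end SheetRRenewalScalar
end Summit.NavierStokesRegularity.OSWSelfSimilar
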